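import Literature.AnabelianGeometry.SemiGraphs.UniversalCoveringOverRigid
import Literature.AnabelianGeometry.SemiGraphs.UniversalCoveringOverMap
import Literature.AnabelianGeometry.SemiGraphs.UniversalCoveringOverBase
import Literature.AnabelianGeometry.SemiGraphs.UniversalCoveringOverDeck

/-!
# `Aut(𝒢_{∞,S})` acts transitively on the fibres ([SemiAnbd] §3 p. 38) — proofs

Proof-only file.  For a CONNECTED covering `S` (all points in one component, `CovObj.SameComponent`)
whose endomorphisms act transitively on every fibre `S_v` (e.g. a connected finite étale GALOIS
covering), the automorphism group of `𝒢_{∞,S} = univCoverOver S c` (based at a vertex-orbit `c`)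
acts transitively on each vertex fibre of `𝒢_{∞,S}`: [SemiAnbd] p. 38, "`𝒢_{∞,i} → 𝒢` … Galois,
`Gal(𝒢_{∞,i}/𝒢)`".  Construction: a point `(V, x, p)` is moved to `(V', x', p')` by
`univCoverOverMap σ` (`σ x = x'`) followed by a base change along a path `σ̄ c ⟶ c` of `𝔾_S`
(connectedness) and a deck transformation; two such morphisms in opposite directions are mutually
inverse by rigidity (`univCoverOver_hom_ext`).
-/

namespace Literature.AnabelianGeometry.SemiGraphs

namespace ProfiniteSemiGraph

open CategoryTheory

universe u

variable {𝒢 : ProfiniteSemiGraph.{u}} (S : CovObj 𝒢) (h𝒢 : 𝒢.IsCountable)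

/-- The component of `𝔾_S` (vertex-orbit or edge-orbit) through a point of `S`.
[cite: MochizukiSemiAnbd2006, Def 3.5(ii) p.37] -/
def CovObj.pointNode : S.Point → S.orbitGraph.CatCarrier
  | Sum.inl ⟨v, x⟩ => Sum.inl (Quot.mk S.VRel ⟨v, x⟩)
  | Sum.inr ⟨e, y⟩ => Sum.inr (Quot.mk S.ERel ⟨e, y⟩)

/-- Points of `S` in the same connected component have orbits joined by a morphism of the
fundamental groupoid of `𝔾_S`. [cite: MochizukiSemiAnbd2006, Def 3.5(ii) p.37] -/
theorem CovObj.nonempty_hom_of_sameComponent {p q : S.Point} (h : S.SameComponent p q) :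
    Nonempty (S.orbitGraph.basept (S.pointNode p) ⟶ S.orbitGraph.basept (S.pointNode q)) := by
  induction h with
  | rel a b hab =>
    cases hab with
    | vertex v g x =>
      refine ⟨eqToHom ?_⟩
      change S.orbitGraph.basept (Sum.inl (Quot.mk S.VRel ⟨v, x⟩)) =
        S.orbitGraph.basept (Sum.inl (Quot.mk S.VRel ⟨v, (S.SV v).obj.ρ g x⟩))
      rw [Quot.sound (CovObj.VRel.mk (S := S) v g x)]
    | edge e g y =>
      refine ⟨eqToHom ?_⟩
      change S.orbitGraph.basept (Sum.inr (Quot.mk S.ERel ⟨e, y⟩)) =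
        S.orbitGraph.basept (Sum.inr (Quot.mk S.ERel ⟨e, (S.SE e).obj.ρ g y⟩))
      rw [Quot.sound (CovObj.ERel.mk (S := S) e g y)]
    | glue b v hb y =>
      exact ⟨S.orbitGraph.brArrow ⟨(b, Quot.mk S.ERel ⟨_, y⟩), rfl⟩ _ _ rfl
        (S.orbitGraph_abuts_mk b v hb ⟨Quot.mk S.ERel ⟨_, y⟩, rfl⟩ y rfl)⟩
  | refl a => exact ⟨𝟙 _⟩
  | symm a b _ ih => exact ⟨inv (Classical.choice ih)⟩
  | trans a b d _ _ ih₁ ih₂ => exact ⟨Classical.choice ih₁ ≫ Classical.choice ih₂⟩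

/-- In a connected covering, any two vertex-orbits are joined by a morphism of the fundamental
groupoid of `𝔾_S`. [cite: MochizukiSemiAnbd2006, Def 3.5(ii) p.37] -/
theorem CovObj.nonempty_hom_inl_inl (hconn : ∀ p q : S.Point, S.SameComponent p q)
    (V W : S.OVertex) :
    Nonempty (S.orbitGraph.basept (Sum.inl V) ⟶ S.orbitGraph.basept (Sum.inl W)) := by
  obtain ⟨x, hx⟩ := CovObj.OVertex.exists_rep S V
  obtain ⟨x', hx'⟩ := CovObj.OVertex.exists_rep S W
  have h := S.nonempty_hom_of_sameComponent (hconn (Sum.inl ⟨_, x⟩) (Sum.inl ⟨_, x'⟩))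
  change Nonempty (S.orbitGraph.basept (Sum.inl (Quot.mk S.VRel ⟨_, x⟩)) ⟶
    S.orbitGraph.basept (Sum.inl (Quot.mk S.VRel ⟨_, x'⟩))) at h
  rw [hx, hx'] at h
  exact h

variable (V₀ : S.OVertex)

/-- For every two points of a vertex fibre of `𝒢_{∞,S}` (based at a vertex-orbit `V₀`) there is an
ENDOMORPHISM of `𝒢_{∞,S}` mapping the first to the second, provided `S` is connected and its
endomorphisms act transitively on `S_v`. [cite: MochizukiSemiAnbd2006, Prop 3.6 p.38] -/
theorem CovObj.exists_hom_apply_eq (hconn : ∀ p q : S.Point, S.SameComponent p q)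
    (htrans : ∀ (v : 𝒢.graph.Vertex) (x x' : (S.SV v).obj.V), ∃ σ : S ⟶ S, (σ.fV v).hom.hom x = x')
    {v : 𝒢.graph.Vertex} (t t' : S.FibV (Sum.inl V₀) v) :
    ∃ η : S.univCoverOver (Sum.inl V₀) h𝒢 ⟶ S.univCoverOver (Sum.inl V₀) h𝒢,
      (η.fV v).hom.hom t = t' := by
  obtain ⟨σ, hσ⟩ := htrans v t.2.1.1 t'.2.1.1
  -- a path from `σ̄ V₀` back to `V₀`
  obtain ⟨q⟩ := S.nonempty_hom_inl_inl hconn (CovObj.OVertex.map σ V₀) V₀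
  -- first two moves: `(V, x, p) ↦ (σ̄ V, σ x, q⁻¹ ≫ σ̄ p)`
  let η₁ := CovObj.univCoverOverMap σ (Sum.inl V₀) h𝒢 ≫ S.baseChangeHom q h𝒢
  -- the target orbit is `σ̄ V`
  have hV : CovObj.OVertex.map σ t.1.1 = t'.1.1 := by
    have h1 := congrArg (CovObj.OVertex.map σ) t.2.1.2
    have h2 := t'.2.1.2
    rw [← hσ] at h2
    exact h1.symm.trans h2
  -- the deck transformation fixing the path
  have hb : S.orbitGraph.basept (Sum.inl (CovObj.OVertex.map σ t.1.1)) =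
      S.orbitGraph.basept (Sum.inl t'.1.1) := by rw [hV]
  let γ : S.orbitGraph.FundamentalGroup (Sum.inl V₀) :=
    (inv q ≫ CovObj.pathMap σ t.2.2) ≫ eqToHom hb ≫ inv t'.2.2
  refine ⟨η₁ ≫ S.deckOver (Sum.inl V₀) h𝒢 γ, ?_⟩
  refine CovObj.FibV.ext S _ (Subtype.ext hV) hσ ?_
  -- the path component: `γ⁻¹ ≫ (q⁻¹ ≫ σ̄ p) = p'`
  change HEq (inv γ ≫ (inv q ≫ CovObj.pathMap σ t.2.2)) t'.2.2
  have aux : ∀ (W : S.OVertex) (e : CovObj.OVertex.map σ t.1.1 = W)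
      (hb' : S.orbitGraph.basept (Sum.inl (CovObj.OVertex.map σ t.1.1)) =
        S.orbitGraph.basept (Sum.inl W))
      (p' : S.orbitGraph.basept (Sum.inl V₀) ⟶ S.orbitGraph.basept (Sum.inl W)),
      HEq (inv ((inv q ≫ CovObj.pathMap σ t.2.2) ≫ eqToHom hb' ≫ inv p') ≫
        (inv q ≫ CovObj.pathMap σ t.2.2)) p' := by
    intro W e hb' p'
    subst e
    apply heq_of_eq
    have hid : (eqToHom hb' : S.orbitGraph.basept (Sum.inl (CovObj.OVertex.map σ t.1.1)) ⟶ _) = 𝟙 _ :=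
      eqToHom_refl _ _
    have e1 : eqToHom hb' ≫ inv p' = inv p' :=
      (congrArg (· ≫ inv p') hid).trans (Category.id_comp _)
    have e2 : inv ((inv q ≫ CovObj.pathMap σ t.2.2) ≫ eqToHom hb' ≫ inv p') =
        p' ≫ inv (inv q ≫ CovObj.pathMap σ t.2.2) := by
      refine (congrArg (fun z => inv ((inv q ≫ CovObj.pathMap σ t.2.2) ≫ z)) e1).trans ?_
      exact IsIso.inv_comp.trans (congrArg (· ≫ inv (inv q ≫ CovObj.pathMap σ t.2.2))
        (IsIso.inv_inv (f := p')))
    refine (congrArg (· ≫ (inv q ≫ CovObj.pathMap σ t.2.2)) e2).trans ?_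
    exact (Category.assoc _ _ _).trans
      ((congrArg (p' ≫ ·) (IsIso.inv_hom_id _)).trans (Category.comp_id p'))
  exact aux _ hV hb _

/-- **`Aut(𝒢_{∞,S})` acts transitively on every vertex fibre of `𝒢_{∞,S}`** (for `S` connected
with point-transitive endomorphisms, e.g. a connected Galois finite étale covering; `𝒢_{∞,S}` based
at a vertex-orbit). [cite: MochizukiSemiAnbd2006, Prop 3.6 p.38] -/
theorem CovObj.exists_aut_apply_eq (hconn : ∀ p q : S.Point, S.SameComponent p q)
    (htrans : ∀ (v : 𝒢.graph.Vertex) (x x' : (S.SV v).obj.V), ∃ σ : S ⟶ S, (σ.fV v).hom.hom x = x')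
    {v : 𝒢.graph.Vertex} (t t' : S.FibV (Sum.inl V₀) v) :
    ∃ η : S.univCoverOver (Sum.inl V₀) h𝒢 ≅ S.univCoverOver (Sum.inl V₀) h𝒢,
      (η.hom.fV v).hom.hom t = t' := by
  obtain ⟨η₁, h₁⟩ := S.exists_hom_apply_eq h𝒢 V₀ hconn htrans t t'
  obtain ⟨η₂, h₂⟩ := S.exists_hom_apply_eq h𝒢 V₀ hconn htrans t' t
  refine ⟨⟨η₁, η₂, ?_, ?_⟩, h₁⟩
  · refine S.univCoverOver_hom_ext _ h𝒢 _ _ t ?_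
    change (η₂.fV v).hom.hom ((η₁.fV v).hom.hom t) = t
    rw [h₁, h₂]
  · refine S.univCoverOver_hom_ext _ h𝒢 _ _ t' ?_
    change (η₁.fV v).hom.hom ((η₂.fV v).hom.hom t') = t'
    rw [h₂, h₁]

end ProfiniteSemiGraph

end Literature.AnabelianGeometry.SemiGraphs
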